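import Summits.ValiantsHypothesis.ValiantsHypothesis.Theorems.SliceSignRankSignRankSuperQPVdwHadamard
import Summits.ValiantsHypothesis.ValiantsHypothesis.Theorems.SliceSignRankSrkNotQPForsterSliceBalanced

/-!
# Route SliceSignRank — crux `SrkNotQP` (stmt-ValiantsHypothesis-20857), line `forster_slice`:
# the registered stub `stub_forsterSlice` is EQUIVALENT to a factorial-power lower bound on `srk`

The registered stub (verbatim the birth stub of crux `SignRankSuperQP`) reads

  `∃ C, ∀ n k W, (W is a k-term sign-representation of sgn on S_n) →
      ∃ V, det V ≠ 0 ∧ n! · per(V ∘ V) ≤ k^C · det(V)²`.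

The twist `V` is quantified INDEPENDENTLY of the representation `W`, so the stub only speaks about
`k` and `n`: it says `k^C ≥ m_n := min_V n! · per(V ∘ V) / det(V)²`. This file makes that reading
kernel-precise:

* `factorial_sq_le_of_forsterTwist` — with the landed van der Waerden–Hadamard inequality
  (`stub_vdwHadamard`: `n! det² ≤ nⁿ per(V∘V)`), any twist as in the stub's conclusion gives
  `(n!)² ≤ nⁿ · k^C`;
* `forsterSlice_iff_factorialPowerLower` — **the stub is equivalent to**
  `∃ C, ∀ n ≥ 3, ∀ k W, (k-term sign-representation of sgn on S_n) → n! ≤ k^C`,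
  i.e. to `srk(n) ≥ (n!)^{1/C}` (`log₂ srk(n) = Ω(n log n)`). Direction ⇒: `(n!)² ≤ nⁿ k^C`,
  `nⁿ ≤ 3ⁿ n!` (exponential series, `e < 3`) and `9ⁿ ≤ n!` (`n ≥ 22`) give `n! ≤ k^{2C}`; for
  `3 ≤ n ≤ 21` Pólya's theorem (no single twist for `n ≥ 3`; taken as the explicit hypothesis
  `hPolya`, stated verbatim as the body of the route support `PolyaOneTwist` and discharged by the
  landed `Theorems.SliceSignRank.polyaOneTwist_proof` — kept as a hypothesis so that this file does
  not import the route file) gives `k ≥ 2` and `n! ≤ 21! < 2^66 ≤ k^66`. Direction ⇐: take `V = 1` (`per(1) = det(1) = 1`) for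
  `n ≠ 2`, and the Hadamard twist `!![1,−1;1,1]` (`2!·per(J₂) = 4 = det²`) at `n = 2` (where `k = 1`
  representations exist, so `n! ≤ k^C` itself fails — hence the cut `n ≥ 3`).

CALIBRATION (honest). The equivalence shows the bet of line `forster_slice` is the EXPONENTIAL form
`srk(n) ≥ (n!)^{Ω(1)}` — far stronger than the crux `SrkNotQP` / `SignRankSuperQP` (super-quasi-
polynomial) it is meant to prove, and far above everything known (`n/4 − o(n) ≤ srk(n)`, landed
`SignRankLinearLower`; no construction better than `n! · c^{−n}` is known either). Neither direction
of the open question is advanced here; the stub and the crux stay OPEN; `VP ≠ VNP` is not touched.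
Landed `--supports stmt-ValiantsHypothesis-20857` (helper of the line).
-/

-- Sub = Summit layout duplicates the namespace component
set_option linter.dupNamespace false

namespace Summit.ValiantsHypothesis.ValiantsHypothesis.Theorems.SliceSignRank.SrkNotQP

open Finset Equiv

/-! ## §1 One Forster twist + van der Waerden–Hadamard ⇒ `(n!)² ≤ nⁿ k^C` -/

/-- **A Forster twist forces `(n!)² ≤ nⁿ · k^C`.** If `det V ≠ 0` and
`n! · per(V ∘ V) ≤ k^C · det(V)²`, then with the landed `stub_vdwHadamard`
(`n! · det(V)² ≤ nⁿ · per(V ∘ V)`) one gets `(n!)² ≤ nⁿ · k^C` after cancelling `det(V)² > 0`.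
(The glue `factorial_sq_le_of_signRep` of the line skeleton, stated for a single twist.) [this file] -/
theorem factorial_sq_le_of_forsterTwist (C n k : ℕ) {V : Matrix (Fin n) (Fin n) ℝ} (hdet : V.det ≠ 0)
    (h1 : (n.factorial : ℝ) * (Matrix.of fun i j => V i j ^ 2).permanent ≤ (k : ℝ) ^ C * V.det ^ 2) :
    (n.factorial : ℝ) ^ 2 ≤ (n : ℝ) ^ n * (k : ℝ) ^ C := by
  have h2 := SignRankSuperQP.stub_vdwHadamard n V
  set P : ℝ := (Matrix.of fun i j => V i j ^ 2).permanent with hP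
  have hd : 0 < V.det ^ 2 := by positivity
  have hf : (0 : ℝ) ≤ n.factorial := Nat.cast_nonneg _
  have hn : (0 : ℝ) ≤ (n : ℝ) ^ n := by positivity
  have h3 : (n.factorial : ℝ) * ((n.factorial : ℝ) * V.det ^ 2) ≤
      (n.factorial : ℝ) * ((n : ℝ) ^ n * P) := mul_le_mul_of_nonneg_left h2 hf
  have h4 : (n : ℝ) ^ n * ((n.factorial : ℝ) * P) ≤ (n : ℝ) ^ n * ((k : ℝ) ^ C * V.det ^ 2) :=
    mul_le_mul_of_nonneg_left h1 hn
  have h5 : (n.factorial : ℝ) ^ 2 * V.det ^ 2 ≤ (n : ℝ) ^ n * (k : ℝ) ^ C * V.det ^ 2 :=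
    calc (n.factorial : ℝ) ^ 2 * V.det ^ 2
        = (n.factorial : ℝ) * ((n.factorial : ℝ) * V.det ^ 2) := by ring
      _ ≤ (n.factorial : ℝ) * ((n : ℝ) ^ n * P) := h3
      _ = (n : ℝ) ^ n * ((n.factorial : ℝ) * P) := by ring
      _ ≤ (n : ℝ) ^ n * ((k : ℝ) ^ C * V.det ^ 2) := h4
      _ = (n : ℝ) ^ n * (k : ℝ) ^ C * V.det ^ 2 := by ring
  exact le_of_mul_le_mul_right h5 hd

/-! ## §2 Elementary growth facts -/

/-- `nⁿ ≤ 3ⁿ · n!` (from `nⁿ / n! ≤ eⁿ` and `e < 3`). [folklore] -/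
theorem pow_self_le_three_pow_mul_factorial (n : ℕ) :
    (n : ℝ) ^ n ≤ 3 ^ n * (n.factorial : ℝ) := by
  have hfac : (0 : ℝ) < n.factorial := by exact_mod_cast Nat.factorial_pos n
  have hE : (n : ℝ) ^ n ≤ Real.exp n * n.factorial := by
    have h := Real.pow_div_factorial_le_exp (x := (n : ℝ)) (Nat.cast_nonneg n) n
    rwa [div_le_iff₀ hfac] at h
  have he3 : Real.exp (n : ℝ) ≤ 3 ^ n := by
    rw [← Real.exp_one_pow n]
    have h1 : Real.exp 1 ≤ 3 := by have := Real.exp_one_lt_d9; linarith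
    exact pow_le_pow_left₀ (Real.exp_pos 1).le h1 n
  calc (n : ℝ) ^ n ≤ Real.exp n * n.factorial := hE
    _ ≤ 3 ^ n * n.factorial := mul_le_mul_of_nonneg_right he3 hfac.le

/-- `9ⁿ ≤ n!` for `n ≥ 22`. [folklore] -/
theorem nine_pow_le_factorial (n : ℕ) (hn : 22 ≤ n) : 9 ^ n ≤ n.factorial := by
  induction n, hn using Nat.le_induction with
  | base => decide
  | succ m hm ih =>
    rw [Nat.factorial_succ, pow_succ]
    calc 9 ^ m * 9 ≤ m.factorial * (m + 1) :=
          Nat.mul_le_mul ih (by omega)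
      _ = (m + 1) * m.factorial := Nat.mul_comm _ _

/-- `21! < 2^66`. [folklore] -/
theorem factorial_twentyone_lt : (21).factorial < 2 ^ 66 := by decide

/-! ## §3 Representations have at least two terms from `n = 3` on (Pólya) -/

/-- For `n ≥ 3` every sign-representation of `sgn` on `S_n` has `k ≥ 2` terms: `k = 0` is the empty
sum and `k = 1` is excluded by Pólya's theorem (hypothesis `hPolya`, verbatim the body of the route
support `PolyaOneTwist`, discharged by the landed `Theorems.SliceSignRank.polyaOneTwist_proof`).
[cite: MarcusMinc1961] -/
theorem two_le_of_signRep
    (hPolya : ∀ n ≥ 3, ¬ ∃ W : Matrix (Fin n) (Fin n) ℝ, ∀ σ : Equiv.Perm (Fin n),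
      0 < ((Equiv.Perm.sign σ : ℤ) : ℝ) * ∏ i, W (σ i) i)
    {n k : ℕ} (hn : 3 ≤ n) (W : Fin k → Matrix (Fin n) (Fin n) ℝ)
    (hrep : ∀ σ : Perm (Fin n), 0 < ((Perm.sign σ : ℤ) : ℝ) * ∑ t, ∏ i, W t (σ i) i) : 2 ≤ k := by
  have hk := pos_of_signRep W hrep
  by_contra hlt
  push Not at hlt
  obtain rfl : k = 1 := by omega
  refine hPolya n hn ⟨W 0, fun σ => ?_⟩
  have h := hrep σ
  simpa [Fin.sum_univ_one] using h

/-! ## §4 Stub ⇒ factorial-power lower bound -/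

/-- **`stub_forsterSlice` implies `srk(n) ≥ (n!)^{1/C'}`**: from the registered stub (verbatim as
hypothesis) there is `C'` with `n! ≤ k^{C'}` for every `k`-term sign-representation of `sgn` on
`S_n`, `n ≥ 3`. (`C' = max(2C, 66)`: `(n!)² ≤ nⁿ k^C ≤ 3ⁿ n! k^C`, `9ⁿ ≤ n!` for `n ≥ 22`;
`k ≥ 2` and `n! ≤ 21! < 2^66` below.) Hypothesis `hPolya` = body of `PolyaOneTwist`, discharged by
the landed `polyaOneTwist_proof`. [this file] -/
theorem factorialPowerLower_of_forsterSlice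
    (hPolya : ∀ n ≥ 3, ¬ ∃ W : Matrix (Fin n) (Fin n) ℝ, ∀ σ : Equiv.Perm (Fin n),
      0 < ((Equiv.Perm.sign σ : ℤ) : ℝ) * ∏ i, W (σ i) i)
    (hA : ∃ C : ℕ, ∀ (n k : ℕ) (W : Fin k → Matrix (Fin n) (Fin n) ℝ),
      (∀ σ : Equiv.Perm (Fin n), 0 < ((Equiv.Perm.sign σ : ℤ) : ℝ) * ∑ t, ∏ i, W t (σ i) i) →
      ∃ V : Matrix (Fin n) (Fin n) ℝ, V.det ≠ 0 ∧
        (n.factorial : ℝ) * (Matrix.of fun i j => V i j ^ 2).permanent ≤ (k : ℝ) ^ C * V.det ^ 2) :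
    ∃ C : ℕ, ∀ (n k : ℕ) (W : Fin k → Matrix (Fin n) (Fin n) ℝ), 3 ≤ n →
      (∀ σ : Equiv.Perm (Fin n), 0 < ((Equiv.Perm.sign σ : ℤ) : ℝ) * ∑ t, ∏ i, W t (σ i) i) →
      n.factorial ≤ k ^ C := by
  obtain ⟨C, hC⟩ := hA
  refine ⟨max (2 * C) 66, fun n k W hn hrep => ?_⟩
  have hk2 : 2 ≤ k := two_le_of_signRep hPolya hn W hrep
  have hk1 : 1 ≤ k := le_trans one_le_two hk2
  obtain ⟨V, hdet, hV⟩ := hC n k W hrep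
  have h1 : (n.factorial : ℝ) ^ 2 ≤ (n : ℝ) ^ n * (k : ℝ) ^ C :=
    factorial_sq_le_of_forsterTwist C n k hdet hV
  rcases Nat.lt_or_ge n 22 with hlt | hge
  · -- 3 ≤ n ≤ 21: n! ≤ 21! < 2^66 ≤ k^66
    have h2 : n.factorial ≤ (21).factorial := Nat.factorial_le (by omega)
    have h3 : 2 ^ 66 ≤ k ^ 66 := Nat.pow_le_pow_left hk2 66
    calc n.factorial ≤ 2 ^ 66 := h2.trans factorial_twentyone_lt.le
      _ ≤ k ^ 66 := h3
      _ ≤ k ^ max (2 * C) 66 := Nat.pow_le_pow_right hk1 (le_max_right _ _)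
  · -- n ≥ 22: n! ≤ 3ⁿ k^C and 3ⁿ ≤ k^C
    have hf : (0 : ℝ) < n.factorial := by exact_mod_cast Nat.factorial_pos n
    have h2 : (n : ℝ) ^ n ≤ 3 ^ n * (n.factorial : ℝ) := pow_self_le_three_pow_mul_factorial n
    have h3 : (9 : ℝ) ^ n ≤ (n.factorial : ℝ) := by
      exact_mod_cast nine_pow_le_factorial n hge
    have hkC : (0 : ℝ) ≤ (k : ℝ) ^ C := by positivity
    have h4 : (n.factorial : ℝ) ≤ 3 ^ n * (k : ℝ) ^ C := by
      have h : (n.factorial : ℝ) * n.factorial ≤ (3 ^ n * (k : ℝ) ^ C) * n.factorial :=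
        calc (n.factorial : ℝ) * n.factorial = (n.factorial : ℝ) ^ 2 := by ring
          _ ≤ (n : ℝ) ^ n * (k : ℝ) ^ C := h1
          _ ≤ (3 ^ n * (n.factorial : ℝ)) * (k : ℝ) ^ C := mul_le_mul_of_nonneg_right h2 hkC
          _ = (3 ^ n * (k : ℝ) ^ C) * n.factorial := by ring
      exact le_of_mul_le_mul_right h hf
    have h5 : (3 : ℝ) ^ n ≤ (k : ℝ) ^ C := by
      have h33 : (3 : ℝ) ^ n * 3 ^ n ≤ 3 ^ n * (k : ℝ) ^ C :=
        calc (3 : ℝ) ^ n * 3 ^ n = 9 ^ n := by rw [← mul_pow]; norm_num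
          _ ≤ (n.factorial : ℝ) := h3
          _ ≤ 3 ^ n * (k : ℝ) ^ C := h4
      exact le_of_mul_le_mul_left h33 (by positivity)
    have h6 : (n.factorial : ℝ) ≤ (k : ℝ) ^ (2 * C) :=
      calc (n.factorial : ℝ) ≤ 3 ^ n * (k : ℝ) ^ C := h4
        _ ≤ (k : ℝ) ^ C * (k : ℝ) ^ C := mul_le_mul_of_nonneg_right h5 hkC
        _ = (k : ℝ) ^ (2 * C) := by rw [two_mul, pow_add]
    have h7 : n.factorial ≤ k ^ (2 * C) := by exact_mod_cast h6
    exact h7.trans (Nat.pow_le_pow_right hk1 (le_max_left _ _))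

/-! ## §5 Factorial-power lower bound ⇒ stub -/

/-- The entrywise square of the identity matrix is the identity matrix. [folklore] -/
theorem of_one_sq (n : ℕ) :
    (Matrix.of fun i j => (1 : Matrix (Fin n) (Fin n) ℝ) i j ^ 2) = 1 := by
  ext i j
  simp only [Matrix.of_apply, Matrix.one_apply]
  split_ifs <;> simp

/-- The permanent of the `2 × 2` all-ones matrix is `2`. [folklore] -/
theorem permanent_ones_two : (Matrix.of fun (_ : Fin 2) (_ : Fin 2) => (1 : ℝ)).permanent = 2 := by
  unfold Matrix.permanent
  simp [Fintype.card_perm]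

/-- **`srk(n) ≥ (n!)^{1/C}` implies `stub_forsterSlice`** (with the same `C`): take `V = 1` for
`n ≠ 2` (`n! · per(1) = n! ≤ k^C = k^C · det(1)²`, using `k ≥ 1` at `n ≤ 1`) and the Hadamard twist
`!![1, −1; 1, 1]` at `n = 2` (`2! · per(J₂) = 4 ≤ k^C · 4`). [this file] -/
theorem forsterSlice_of_factorialPowerLower
    (hL : ∃ C : ℕ, ∀ (n k : ℕ) (W : Fin k → Matrix (Fin n) (Fin n) ℝ), 3 ≤ n →
      (∀ σ : Equiv.Perm (Fin n), 0 < ((Equiv.Perm.sign σ : ℤ) : ℝ) * ∑ t, ∏ i, W t (σ i) i) →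
      n.factorial ≤ k ^ C) :
    ∃ C : ℕ, ∀ (n k : ℕ) (W : Fin k → Matrix (Fin n) (Fin n) ℝ),
      (∀ σ : Equiv.Perm (Fin n), 0 < ((Equiv.Perm.sign σ : ℤ) : ℝ) * ∑ t, ∏ i, W t (σ i) i) →
      ∃ V : Matrix (Fin n) (Fin n) ℝ, V.det ≠ 0 ∧
        (n.factorial : ℝ) * (Matrix.of fun i j => V i j ^ 2).permanent ≤ (k : ℝ) ^ C * V.det ^ 2 := by
  obtain ⟨C, hC⟩ := hL
  refine ⟨C, fun n k W hrep => ?_⟩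
  have hk : 0 < k := pos_of_signRep W hrep
  have hk1 : (1 : ℝ) ≤ (k : ℝ) ^ C := one_le_pow₀ (by exact_mod_cast hk)
  by_cases h2 : n = 2
  · -- n = 2: the Hadamard twist
    subst h2
    refine ⟨!![1, -1; 1, 1], ?_, ?_⟩
    · rw [Matrix.det_fin_two_of]; norm_num
    · have hsq : (Matrix.of fun i j => (!![1, -1; 1, 1] : Matrix (Fin 2) (Fin 2) ℝ) i j ^ 2) =
          Matrix.of fun _ _ => (1 : ℝ) := by
        ext i j; fin_cases i <;> fin_cases j <;> simp
      rw [hsq, permanent_ones_two, Matrix.det_fin_two_of]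
      norm_num [Nat.factorial]
      linarith
  · -- n ≠ 2: the identity twist, with `n! ≤ k^C`
    have hfac : (n.factorial : ℝ) ≤ (k : ℝ) ^ C := by
      rcases Nat.lt_or_ge n 3 with hlt | hge
      · have hn1 : n.factorial = 1 := by interval_cases n <;> simp_all
        rw [hn1]; simpa using hk1
      · exact_mod_cast hC n k W hge hrep
    refine ⟨1, by simp, ?_⟩
    rw [of_one_sq, Matrix.permanent_one, Matrix.det_one]
    simpa using hfac

/-! ## §6 The equivalence -/

/-- **The registered stub `stub_forsterSlice` of line `forster_slice` (crux `SrkNotQP`,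
stmt-ValiantsHypothesis-20857; verbatim the birth stub of `SignRankSuperQP`) is EQUIVALENT to the
factorial-power lower bound on sign-representations of `sgn`**:
`(∃ C, ∀ n k W, rep → ∃ V, det V ≠ 0 ∧ n!·per(V∘V) ≤ k^C det(V)²) ↔
 (∃ C, ∀ n ≥ 3, ∀ k W, rep → n! ≤ k^C)`, i.e. `srk(n) ≥ (n!)^{Ω(1)}`.
Both sides are OPEN (conjecture-grade); this is calibration of the bet, not progress on it.
Hypothesis `hPolya` = body of `PolyaOneTwist` (landed: `polyaOneTwist_proof`). [this file] -/
theorem forsterSlice_iff_factorialPowerLower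
    (hPolya : ∀ n ≥ 3, ¬ ∃ W : Matrix (Fin n) (Fin n) ℝ, ∀ σ : Equiv.Perm (Fin n),
      0 < ((Equiv.Perm.sign σ : ℤ) : ℝ) * ∏ i, W (σ i) i) :
    (∃ C : ℕ, ∀ (n k : ℕ) (W : Fin k → Matrix (Fin n) (Fin n) ℝ),
      (∀ σ : Equiv.Perm (Fin n), 0 < ((Equiv.Perm.sign σ : ℤ) : ℝ) * ∑ t, ∏ i, W t (σ i) i) →
      ∃ V : Matrix (Fin n) (Fin n) ℝ, V.det ≠ 0 ∧
        (n.factorial : ℝ) * (Matrix.of fun i j => V i j ^ 2).permanent ≤ (k : ℝ) ^ C * V.det ^ 2) ↔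
    (∃ C : ℕ, ∀ (n k : ℕ) (W : Fin k → Matrix (Fin n) (Fin n) ℝ), 3 ≤ n →
      (∀ σ : Equiv.Perm (Fin n), 0 < ((Equiv.Perm.sign σ : ℤ) : ℝ) * ∑ t, ∏ i, W t (σ i) i) →
      n.factorial ≤ k ^ C) :=
  ⟨factorialPowerLower_of_forsterSlice hPolya, forsterSlice_of_factorialPowerLower⟩

end Summit.ValiantsHypothesis.ValiantsHypothesis.Theorems.SliceSignRank.SrkNotQP
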